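import Literature.NumberTheory.EllipticCurves.Kato2004.Condition1252
import HarnessLib

/-!
# The tower from surj(p) and ONE Galois element read on `E[p²]` (first-order witness, torsion form)

`Proofs` file (theorems only: no definition, no named fact), topic `NumberTheory/EllipticCurves`,
sequel of `Kato2004/Condition1252.lean` (unit `b2b-bsdres-lit-kato`): there the `p`-adic tower
"`ρ̄_{E,p}` onto and ONE `τ ∈ Γ_ℚ` acting on `T_pE` as `1 + pM₀ + p²V` with `M₀ mod p`
non-scalar of unit trace ⟹ every `ρ̄_{E,p^n}` onto" is proved
(`WeierstrassCurve.forall_hasSurjectiveModNGaloisRep_of_firstOrderWitness`, J.-P. Serre,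
*Abelian ℓ-adic representations* (1968), IV-23, Lemma 3 and its proof; N. D. Elkies,
arXiv:math/0612734, §1, for the failure at `p = 3` without a witness).  This file restates the
witness ON THE TORSION: a `τ ∈ Γ_ℚ` which

* fixes `E[p]` pointwise,
* is NOT of the form `Q ↦ (1 + p m) Q` on `E[p²]` (not a scalar `≡ 1 (mod p)`), and
* moves some `p²`-th root of unity (`χ_p(τ) ≢ 1 (mod p²)`),

is a first-order witness (`WeierstrassCurve.exists_firstOrderWitness_of_torsion`), so that with
`ρ̄_{E,p}` onto the whole tower follows
(`WeierstrassCurve.forall_hasSurjectiveModNGaloisRep_of_torsionWitness`, `p` odd).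

Dictionary (Silverman, *AEC*, III.§7–§8): `E[p^n] = π_n(T_pE)`, `ker π₁ = p T_pE`
(`TateModule.p_smul_div`), `π_n(x • t) = (x mod p^n) • π_n t` (`TateModule.proj_smul`); so
`τ|_{E[p]} = 1` gives `ρ(τ) = 1 + pM₀` in any `ℤ_p`-basis, "`M₀ ≡ a (mod p)` scalar" reads
"`τ Q = (1 + pa) Q` on `E[p²]`", and `det ρ(τ) = 1 + p·tr M₀ + p² det M₀ ≡ χ_p(τ) (mod p²)`
(`det ρ_{E,p} = χ_p` from the Weil pairing, tree theorem `toZModPow_det_galoisRepTate_eq`), so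
`tr M₀ ∈ ℤ_pˣ` iff `τ` moves a `p²`-th root of unity.

Use (cell `bsd-rank1-residual`, team n1011, sub-target T-b2): at a good supersingular `3` the
inertia group supplies such a `τ` (`Wuthrich2014/ThreeAdicImageSupersingularProofs.lean`).

## References

* [SerreAbelianLadic1968] J.-P. Serre, *Abelian ℓ-adic representations and elliptic curves*
  (1968), Ch. IV §3.4, Lemma 3 (IV-23) and its proof.
* [SilvermanAEC2009] J. H. Silverman, *The Arithmetic of Elliptic Curves*, 2nd ed. (2009),
  III.§7 (`T_ℓE`), Prop. III.8.1, III.8.3 (Weil pairing, `det = χ`).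
* [Elkies2006] N. D. Elkies, arXiv:math/0612734, Introduction and §1.
-/

noncomputable section

open scoped Classical
open Field

namespace WeierstrassCurve

open Literature.NumberTheory.EllipticCurves Literature.NumberTheory.GaloisRepresentations

variable (W : WeierstrassCurve ℚ) (p : ℕ) [Fact p.Prime]

/-- A non-unit of `ℤ_p` is divisible by `p`. [folklore] -/
private theorem dvd_of_not_isUnit' {z : ℤ_[p]} (hz : ¬ IsUnit z) : (p : ℤ_[p]) ∣ z := by
  rw [← PadicInt.norm_lt_one_iff_dvd]
  exact lt_of_le_of_ne (PadicInt.norm_le_one z) (fun h ↦ hz (PadicInt.isUnit_iff.mpr h))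

/-- `π_n((p^n) • s) = 0` on the Tate module. [folklore] -/
private theorem proj_pow_smul_eq_zero (n : ℕ) (s : W.tateModule p) :
    TateModule.proj p n (((p : ℤ_[p]) ^ n) • s) = 0 := by
  rw [TateModule.proj_smul, map_pow, map_natCast, ← Nat.cast_pow, ZMod.natCast_self, ZMod.val_zero,
    zero_smul]

/-- `π₂((p a) • t) = (p · (a mod p²)) • π₂ t` on the Tate module (the component `π₂ t` is
`p²`-torsion). [folklore] -/
private theorem proj_two_p_mul_smul (a : ℤ_[p]) (t : W.tateModule p) :
    TateModule.proj p 2 (((p : ℤ_[p]) * a) • t) =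
      (p * (PadicInt.toZModPow 2 a).val) • TateModule.proj p 2 t := by
  have hp : p.Prime := Fact.out
  have hlt : p < p ^ 2 := by nlinarith [hp.two_le]
  have hmem := proj_tateModule_mem_geomTorsion W p 2 t
  rw [TateModule.proj_smul, map_mul, map_natCast, ZMod.val_mul, ZMod.val_natCast,
    Nat.mod_eq_of_lt hlt, ← AddSubgroup.torsionBy.mod_self_nsmul' _ hmem]

/-- **A Galois element fixing `E[p]`, non-scalar on `E[p²]` and moving a `p²`-th root of unity is a
first-order witness.**  Let `τ ∈ Γ_ℚ` fix `E[p]` pointwise, suppose `τ` does NOT act on `E[p²]` as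
`Q ↦ (1 + pm) Q` for a single `m ∈ ℕ`, and suppose `τ t ≠ t` for some `t` with `t^{p²} = 1`.
Then in any `ℤ_p`-basis `b` of `T_pE`, `ρ_{E,p}(τ) = 1 + p M₀ + p² V` with `M₀ mod p` non-scalar
(a unit off-diagonal entry or a unit difference of diagonal entries) and `tr M₀ ∈ ℤ_pˣ`.
(`ker π₁ = pT_pE`; `det ρ = χ_p` via the Weil pairing.)
[cite: SerreAbelianLadic1968, Ch. IV §3.4, Lemma 3 (IV-23), proof]
[cite: SilvermanAEC2009, III.§7 and Prop. III.8.1] -/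
theorem exists_firstOrderWitness_of_torsion [W.IsElliptic] (τ : absoluteGaloisGroup ℚ)
    (b : Module.Basis (Fin 2) ℤ_[p] (W.tateModule p))
    (h1 : ∀ P ∈ geomTorsion W p, τ • P = P)
    (hns : ¬ ∃ m : ℕ, ∀ Q ∈ geomTorsion W (p ^ 2 : ℕ), τ • Q = (1 + p * m) • Q)
    (hζ : ∃ t : AlgebraicClosure ℚ, t ^ p ^ 2 = 1 ∧ τ • t ≠ t) :
    ∃ M₀ : Matrix (Fin 2) (Fin 2) ℤ_[p],
      (∃ (τ' : absoluteGaloisGroup ℚ) (V : Matrix (Fin 2) (Fin 2) ℤ_[p]),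
        LinearMap.toMatrix b b (W.galoisRepTate p τ') =
          1 + (p : ℤ_[p]) • M₀ + ((p : ℤ_[p]) ^ 2) • V) ∧
      (IsUnit (M₀ 1 0) ∨ IsUnit (M₀ 0 1) ∨ IsUnit (M₀ 0 0 - M₀ 1 1)) ∧ IsUnit M₀.trace := by
  have hp : p.Prime := Fact.out
  have hp0 : (p : ℚ) ≠ 0 := Nat.cast_ne_zero.mpr hp.ne_zero
  haveI : NeZero (p : ℚ) := ⟨hp0⟩
  set L : W.tateModule p →ₗ[ℤ_[p]] W.tateModule p := W.galoisRepTate p τ with hL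
  -- Step 1: `ρ(τ) ≡ 1 (mod p)`: `L (b j) = b j + p • c j`
  have h0 : ∀ j, TateModule.proj p 1 (L (b j) - b j) = 0 := by
    intro j
    have hmem : TateModule.proj p 1 (b j) ∈ geomTorsion W p := by
      have := proj_tateModule_mem_geomTorsion W p 1 (b j)
      rwa [pow_one] at this
    rw [map_sub, hL, galoisRepTate_apply_apply, TateModule.proj_smul_of_distribMulAction,
      h1 _ hmem, sub_self]
  set c : Fin 2 → W.tateModule p := fun j ↦ TateModule.div (L (b j) - b j) (h0 j) with hc
  have hLb : ∀ j, L (b j) = b j + (p : ℤ_[p]) • c j := by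
    intro j
    rw [hc]
    simp only [TateModule.p_smul_div]
    abel
  set M₀ : Matrix (Fin 2) (Fin 2) ℤ_[p] := Matrix.of fun i j ↦ b.repr (c j) i with hM₀
  have hmat : LinearMap.toMatrix b b L = 1 + (p : ℤ_[p]) • M₀ + ((p : ℤ_[p]) ^ 2) • 0 := by
    ext i j
    rw [smul_zero, add_zero, LinearMap.toMatrix_apply, hLb, map_add, map_smul, Finsupp.add_apply,
      Finsupp.smul_apply, Module.Basis.repr_self, Matrix.add_apply, Matrix.smul_apply,
      Matrix.one_apply, hM₀, Matrix.of_apply, smul_eq_mul, Finsupp.single_apply]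
    by_cases hij : i = j
    · subst hij; simp
    · simp [hij, Ne.symm hij]
  refine ⟨M₀, ⟨τ, 0, hmat⟩, ?_, ?_⟩
  · -- Step 2: `M₀ mod p` is not scalar, for otherwise `τ` acts on `E[p²]` as `(1 + pa)·`
    by_contra hall
    push Not at hall
    obtain ⟨h10, h01, hdiag⟩ := hall
    obtain ⟨u10, hu10⟩ := dvd_of_not_isUnit' p h10
    obtain ⟨u01, hu01⟩ := dvd_of_not_isUnit' p h01
    obtain ⟨ud, hud⟩ := dvd_of_not_isUnit' p hdiag
    set a : ℤ_[p] := M₀ 1 1 with ha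
    set N : Matrix (Fin 2) (Fin 2) ℤ_[p] := !![ud, u01; u10, 0] with hN
    have hM₀eq : M₀ = a • (1 : Matrix (Fin 2) (Fin 2) ℤ_[p]) + (p : ℤ_[p]) • N := by
      ext i j
      fin_cases i <;> fin_cases j
      · change M₀ 0 0 = _
        have : M₀ 0 0 = a + p * ud := by rw [ha]; linear_combination hud
        simp [hN, this]
      · change M₀ 0 1 = _
        simp [hN, hu01]
      · change M₀ 1 0 = _
        simp [hN, hu10]
      · change M₀ 1 1 = _
        simp [hN, ha]
    -- `L = 1 + (p a) • 1 + p² • (toLin N)`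
    have hLeq : L = LinearMap.id + ((p : ℤ_[p]) * a) • LinearMap.id +
        ((p : ℤ_[p]) ^ 2) • Matrix.toLin b b N := by
      have h := congrArg (Matrix.toLin b b) hmat
      rw [Matrix.toLin_toMatrix, smul_zero, add_zero, hM₀eq] at h
      rw [h, map_add, map_smul, Matrix.toLin_one, map_add, map_smul, map_smul, Matrix.toLin_one,
        smul_add, smul_smul, smul_smul, ← pow_two]
      simp only [add_assoc]
    apply hns
    refine ⟨(PadicInt.toZModPow 2 a).val, fun Q hQ ↦ ?_⟩
    obtain ⟨t, ht⟩ := proj_surjective_of_isAlgClosed_holds W p 2 hQ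
    have key : TateModule.proj p 2 (L t) = τ • Q := by
      rw [hL, galoisRepTate_apply_apply, TateModule.proj_smul_of_distribMulAction, ht]
    rw [hLeq, LinearMap.add_apply, LinearMap.add_apply, LinearMap.smul_apply, LinearMap.smul_apply,
      LinearMap.id_apply, map_add, map_add, proj_two_p_mul_smul, proj_pow_smul_eq_zero, add_zero,
      ht] at key
    rw [← key, add_smul, one_smul]
  · -- Step 3: `tr M₀ ∈ ℤ_pˣ`, for otherwise `χ_p(τ) ≡ det ρ(τ) ≡ 1 (mod p²)`
    by_contra htr
    obtain ⟨z, hz⟩ := dvd_of_not_isUnit' p htr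
    obtain ⟨t, ht, hτt⟩ := hζ
    -- `det ρ(τ) = 1 + p tr M₀ + p² det M₀`
    have htr' : M₀ 0 0 + M₀ 1 1 = p * z := by rw [← hz, Matrix.trace_fin_two]
    have hmat2 : LinearMap.toMatrix b b L =
        !![1 + (p : ℤ_[p]) * M₀ 0 0, (p : ℤ_[p]) * M₀ 0 1;
          (p : ℤ_[p]) * M₀ 1 0, 1 + (p : ℤ_[p]) * M₀ 1 1] := by
      rw [hmat, smul_zero, add_zero]
      ext i j
      fin_cases i <;> fin_cases j <;> simp
    have hdet : LinearMap.det L = 1 + (p : ℤ_[p]) ^ 2 * (z + M₀.det) := by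
      rw [← LinearMap.det_toMatrix b, hmat2, Matrix.det_fin_two_of, Matrix.det_fin_two]
      linear_combination (p : ℤ_[p]) * htr'
    have hdet2 : PadicInt.toZModPow 2 (LinearMap.det L) = 1 := by
      rw [hdet, map_add, map_one, map_mul, map_pow, map_natCast, ← Nat.cast_pow, ZMod.natCast_self,
        zero_mul, add_zero]
    -- `det ρ(τ) ≡ c (mod p²)` where `τ` acts on `μ_{p²}` by `c = χ_p(τ) mod p²`
    set c : ℕ := ((GaloisRep.cyclotomicCharacter ℚ p τ).val.toZModPow 2).val with hcdef
    have hc : ∀ s : AlgebraicClosure ℚ, s ^ p ^ (1 + 1) = 1 → τ • s = s ^ c := fun s hs ↦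
      GaloisRep.cyclotomicCharacter_spec ℚ p (k := 2) τ s hs
    have hdetc := toZModPow_det_galoisRepTate_eq W p hp0 1 (exists_weilPairing_holds W _) τ c hc
    rw [← hL, hdet2] at hdetc
    -- so `c ≡ 1 (mod p²)`, i.e. `τ` fixes the `p²`-th roots of unity
    have hc1 : c = 1 := by
      haveI : Fact (1 < p ^ (1 + 1)) := ⟨Nat.one_lt_pow (by norm_num) hp.one_lt⟩
      have h2 : ((c : ZMod (p ^ (1 + 1))) : ZMod (p ^ (1 + 1))).val = 1 := by
        rw [← hdetc, ZMod.val_one]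
      rw [ZMod.val_natCast] at h2
      have hclt : c < p ^ (1 + 1) := by rw [hcdef]; exact ZMod.val_lt _
      rwa [Nat.mod_eq_of_lt hclt] at h2
    exact hτt (by rw [hc t ht, hc1, pow_one])

/-- **The tower from surj(p) and a torsion-level witness** (`p` odd): if `ρ̄_{E,p}` is onto and some
`τ ∈ Γ_ℚ` fixes `E[p]` pointwise, is not a scalar `(1 + pm)·` on `E[p²]`, and moves a `p²`-th
root of unity, then `ρ̄_{E,p^n}` is onto for every `n` (Serre's lifting lemma IV-23 with the base
step supplied by the witness: `exists_firstOrderWitness_of_torsion` +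
`forall_hasSurjectiveModNGaloisRep_of_firstOrderWitness`).
[cite: SerreAbelianLadic1968, Ch. IV §3.4, Lemma 3 (IV-23)] [cite: Elkies2006, Introduction (p. 1) and §1] -/
theorem forall_hasSurjectiveModNGaloisRep_of_torsionWitness [W.IsElliptic] (hp2 : p ≠ 2)
    (hsurj : W.HasSurjectiveModNGaloisRep p) (τ : absoluteGaloisGroup ℚ)
    (h1 : ∀ P ∈ geomTorsion W p, τ • P = P)
    (hns : ¬ ∃ m : ℕ, ∀ Q ∈ geomTorsion W (p ^ 2 : ℕ), τ • Q = (1 + p * m) • Q)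
    (hζ : ∃ t : AlgebraicClosure ℚ, t ^ p ^ 2 = 1 ∧ τ • t ≠ t) (n : ℕ) :
    W.HasSurjectiveModNGaloisRep (p ^ n : ℕ) := by
  have hp : p.Prime := Fact.out
  have hp0 : (p : ℚ) ≠ 0 := Nat.cast_ne_zero.mpr hp.ne_zero
  haveI : Module.Free ℤ_[p] (W.tateModule p) := module_free_tateModule_holds W p
  haveI : Module.Finite ℤ_[p] (W.tateModule p) := module_finite_tateModule_holds W p
  let b : Module.Basis (Fin 2) ℤ_[p] (W.tateModule p) :=
    Module.finBasisOfFinrankEq ℤ_[p] (W.tateModule p) (finrank_tateModule_eq_two_holds W p hp0)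
  obtain ⟨M₀, hM₀, hns', htr⟩ := W.exists_firstOrderWitness_of_torsion p τ b h1 hns hζ
  exact forall_hasSurjectiveModNGaloisRep_of_firstOrderWitness hp2 hsurj b M₀ hM₀ hns' htr n

/-- The same at `p = 3`, in the binder shape `∀ n, W.HasSurjectiveModNGaloisRep (3 ^ n)` of the
tree's `p = 3` readings (Wuthrich 2014 Lemma 20; Kato's (12.5.2) via
`Kato2004.imageContainsSL2_iff_forall_hasSurjectiveModNGaloisRep`).
[cite: SerreAbelianLadic1968, Ch. IV §3.4, Lemma 3 (IV-23)] [cite: Elkies2006, Introduction (p. 1) and §1] -/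
theorem forall_hasSurjectiveModNGaloisRep_three_pow_of_torsionWitness [W.IsElliptic]
    (hsurj : W.HasSurjectiveModNGaloisRep 3) (τ : absoluteGaloisGroup ℚ)
    (h1 : ∀ P ∈ geomTorsion W 3, τ • P = P)
    (hns : ¬ ∃ m : ℕ, ∀ Q ∈ geomTorsion W 9, τ • Q = (1 + 3 * m) • Q)
    (hζ : ∃ t : AlgebraicClosure ℚ, t ^ 9 = 1 ∧ τ • t ≠ t) (n : ℕ) :
    W.HasSurjectiveModNGaloisRep (3 ^ n : ℕ) := by
  haveI : Fact (Nat.Prime 3) := ⟨Nat.prime_three⟩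
  refine W.forall_hasSurjectiveModNGaloisRep_of_torsionWitness 3 (by norm_num) hsurj τ h1 ?_ ?_ n
  · simpa using hns
  · simpa using hζ

end WeierstrassCurve

end
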